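import Literature.NumberTheory.Transcendental.BrownZagierCoefficients
import Literature.NumberTheory.Transcendental.BrownLevelOneProofs
import Literature.NumberTheory.Transcendental.MultipleZetaRepeatedTwosProofs
import Literature.NumberTheory.Transcendental.MultipleZetaWeightFiveProofs
import Literature.NumberTheory.Transcendental.MultipleZetaWeightSevenProofs
import Literature.NumberTheory.Transcendental.MultipleZetaWeightNineValuesTwoProofs
import HarnessLib

/-!
# Brown 2012, Theorem 4.1 (Zagier's theorem) in weights `≤ 9`

Sibling proof file in the cone of the named fact
`Literature.NumberTheory.Transcendental.hoffmanSpan_eq_mzvSpace` (Brown 2012, Theorem 1.1).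
Zagier's evaluation of the Hoffman elements of odd weight with a single `3` — Brown 2012,
**Theorem 4.1** (Zagier 2012): for `a, b ≥ 0`,
`ζ(2^{a} 3 2^{b}) = 2 ∑_{r=1}^{a+b+1} (-1)ʳ (A^r_{a,b} - B^r_{a,b}) ζ(2r+1) ζ(2^{a+b+1-r})`,
`A^r_{a,b} = C(2r, 2a+2)`, `B^r_{a,b} = (1 - 2^{-2r}) C(2r, 2b+1)` (`Brown2012.zagierA`,
`Brown2012.zagierB`) — is the "key arithmetic input" of Brown's proof; its general proof
(Zagier, Ann. of Math. 175 (2012), via generating functions and hypergeometric identities) is not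
formalised here. This file PROVES all its instances of weight `2(a+b)+3 ≤ 9`, i.e. `a + b ≤ 3`
(ten words), from the weight-`5`, `7`, `9` evaluations of the tree
(`MultipleZetaWeightFiveProofs`, `…SevenProofs`, `…NineValuesTwoProofs`, obtained there from the
finite double shuffle and duality relations) and `ζ({2}ᵏ) = π^{2k}/(2k+1)!`
(`multipleZeta_replicate_two`): an independent consistency check of those tables against Zagier's
closed formula, and of the definitions `zagierA`, `zagierB`.

Conventions: Brown sums `0 < k₁ < ⋯ < k_r` (eq. (1.1)), the tree's `multipleZeta` sums
`n₁ > ⋯ > n_r` (Zagier 1994), so Brown's word `2^{a} 3 2^{b}` is the index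
`List.replicate b 2 ++ 3 :: List.replicate a 2` here. The sum over `r = 1, …, n` (`n = a+b+1`) is
written `∑_{r ∈ range n}` with `r ↦ r + 1`.

## References

* F. Brown, *Mixed Tate motives over ℤ*, Ann. of Math. **175** (2012), 949–976, Theorem 4.1
  (arXiv:1102.1312, p. 11). [Brown2012]
* D. Zagier, *Evaluation of the multiple zeta values `ζ(2,…,2,3,2,…,2)`*, Ann. of Math. **175**
  (2012), 977–1000, Theorem 1. [Zagier2012]
-/

noncomputable section

open scoped BigOperators Nat
open Real

namespace Literature.NumberTheory.Transcendental

namespace Brown2012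

/-- `ζ(2,2,2) = π⁶/5040`. [cite: Hoffman1992, Corollary 2.3] -/
theorem multipleZeta_twos_three : multipleZeta [2, 2, 2] = π ^ 6 / 5040 := by
  rw [show [2, 2, 2] = List.replicate 3 2 from rfl, multipleZeta_replicate_two]
  norm_num [Nat.factorial]


/-- **Zagier's theorem** (Brown 2012, Theorem 4.1) for `w = 3` (`a = 0`, `b = 0`, weight `3`):
`ζ_Brown(3) = multipleZeta [3] = 2 ∑_{r=1}^{1} (-1)ʳ (A^r_{0,0} - B^r_{0,0}) ζ(2r+1) ζ({2}^{1-r})`.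
[cite: Brown2012, Theorem 4.1] -/
theorem zagierFormula_0_0 :
    multipleZeta [3] =
      2 * ∑ r ∈ Finset.range 1, (-1 : ℝ) ^ (r + 1) *
        ((zagierA (r + 1) 0 - zagierB (r + 1) 0 : ℚ) : ℝ) *
          (multipleZeta [2 * r + 3] * multipleZeta (List.replicate (1 - 1 - r) 2)) := by
  simp only [Finset.sum_range_succ, Finset.sum_range_zero, zagierA_def, zagierB_def]
  push_cast
  norm_num [Nat.choose, List.replicate, multipleZeta_nil]
  ring

/-- **Zagier's theorem** (Brown 2012, Theorem 4.1) for `w = 23` (`a = 1`, `b = 0`, weight `5`):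
`ζ_Brown(2,3) = multipleZeta [3, 2] = 2 ∑_{r=1}^{2} (-1)ʳ (A^r_{1,0} - B^r_{1,0}) ζ(2r+1) ζ({2}^{2-r})`.
[cite: Brown2012, Theorem 4.1] -/
theorem zagierFormula_1_0 :
    multipleZeta [3, 2] =
      2 * ∑ r ∈ Finset.range 2, (-1 : ℝ) ^ (r + 1) *
        ((zagierA (r + 1) 1 - zagierB (r + 1) 0 : ℚ) : ℝ) *
          (multipleZeta [2 * r + 3] * multipleZeta (List.replicate (2 - 1 - r) 2)) := by
  simp only [Finset.sum_range_succ, Finset.sum_range_zero, zagierA_def, zagierB_def]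
  push_cast
  norm_num [Nat.choose, List.replicate, multipleZeta_nil]
  linear_combination multipleZeta_three_two_eq

/-- **Zagier's theorem** (Brown 2012, Theorem 4.1) for `w = 32` (`a = 0`, `b = 1`, weight `5`):
`ζ_Brown(3,2) = multipleZeta [2, 3] = 2 ∑_{r=1}^{2} (-1)ʳ (A^r_{0,1} - B^r_{0,1}) ζ(2r+1) ζ({2}^{2-r})`.
[cite: Brown2012, Theorem 4.1] -/
theorem zagierFormula_0_1 :
    multipleZeta [2, 3] =
      2 * ∑ r ∈ Finset.range 2, (-1 : ℝ) ^ (r + 1) *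
        ((zagierA (r + 1) 0 - zagierB (r + 1) 1 : ℚ) : ℝ) *
          (multipleZeta [2 * r + 3] * multipleZeta (List.replicate (2 - 1 - r) 2)) := by
  simp only [Finset.sum_range_succ, Finset.sum_range_zero, zagierA_def, zagierB_def]
  push_cast
  norm_num [Nat.choose, List.replicate, multipleZeta_nil]
  linear_combination multipleZeta_two_three_eq

/-- **Zagier's theorem** (Brown 2012, Theorem 4.1) for `w = 223` (`a = 2`, `b = 0`, weight `7`):
`ζ_Brown(2,2,3) = multipleZeta [3, 2, 2] = 2 ∑_{r=1}^{3} (-1)ʳ (A^r_{2,0} - B^r_{2,0}) ζ(2r+1) ζ({2}^{3-r})`.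
[cite: Brown2012, Theorem 4.1] -/
theorem zagierFormula_2_0 :
    multipleZeta [3, 2, 2] =
      2 * ∑ r ∈ Finset.range 3, (-1 : ℝ) ^ (r + 1) *
        ((zagierA (r + 1) 2 - zagierB (r + 1) 0 : ℚ) : ℝ) *
          (multipleZeta [2 * r + 3] * multipleZeta (List.replicate (3 - 1 - r) 2)) := by
  simp only [Finset.sum_range_succ, Finset.sum_range_zero, zagierA_def, zagierB_def]
  push_cast
  norm_num [Nat.choose, List.replicate, multipleZeta_nil]
  linear_combination multipleZeta_three_two_two_eq + ((-3 : ℝ) * multipleZeta [3]) * multipleZeta_two_two + ((15 / 2 : ℝ) * multipleZeta [5]) * multipleZeta_two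

/-- **Zagier's theorem** (Brown 2012, Theorem 4.1) for `w = 232` (`a = 1`, `b = 1`, weight `7`):
`ζ_Brown(2,3,2) = multipleZeta [2, 3, 2] = 2 ∑_{r=1}^{3} (-1)ʳ (A^r_{1,1} - B^r_{1,1}) ζ(2r+1) ζ({2}^{3-r})`.
[cite: Brown2012, Theorem 4.1] -/
theorem zagierFormula_1_1 :
    multipleZeta [2, 3, 2] =
      2 * ∑ r ∈ Finset.range 3, (-1 : ℝ) ^ (r + 1) *
        ((zagierA (r + 1) 1 - zagierB (r + 1) 1 : ℚ) : ℝ) *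
          (multipleZeta [2 * r + 3] * multipleZeta (List.replicate (3 - 1 - r) 2)) := by
  simp only [Finset.sum_range_succ, Finset.sum_range_zero, zagierA_def, zagierB_def]
  push_cast
  norm_num [Nat.choose, List.replicate, multipleZeta_nil]
  linear_combination multipleZeta_two_three_two_eq + ((11 / 2 : ℝ) * multipleZeta [5]) * multipleZeta_two

/-- **Zagier's theorem** (Brown 2012, Theorem 4.1) for `w = 322` (`a = 0`, `b = 2`, weight `7`):
`ζ_Brown(3,2,2) = multipleZeta [2, 2, 3] = 2 ∑_{r=1}^{3} (-1)ʳ (A^r_{0,2} - B^r_{0,2}) ζ(2r+1) ζ({2}^{3-r})`.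
[cite: Brown2012, Theorem 4.1] -/
theorem zagierFormula_0_2 :
    multipleZeta [2, 2, 3] =
      2 * ∑ r ∈ Finset.range 3, (-1 : ℝ) ^ (r + 1) *
        ((zagierA (r + 1) 0 - zagierB (r + 1) 2 : ℚ) : ℝ) *
          (multipleZeta [2 * r + 3] * multipleZeta (List.replicate (3 - 1 - r) 2)) := by
  simp only [Finset.sum_range_succ, Finset.sum_range_zero, zagierA_def, zagierB_def]
  push_cast
  norm_num [Nat.choose, List.replicate, multipleZeta_nil]
  linear_combination multipleZeta_two_two_three_eq + ((2 : ℝ) * multipleZeta [3]) * multipleZeta_two_two + ((-12 : ℝ) * multipleZeta [5]) * multipleZeta_two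

/-- **Zagier's theorem** (Brown 2012, Theorem 4.1) for `w = 2223` (`a = 3`, `b = 0`, weight `9`):
`ζ_Brown(2,2,2,3) = multipleZeta [3, 2, 2, 2] = 2 ∑_{r=1}^{4} (-1)ʳ (A^r_{3,0} - B^r_{3,0}) ζ(2r+1) ζ({2}^{4-r})`.
[cite: Brown2012, Theorem 4.1] -/
theorem zagierFormula_3_0 :
    multipleZeta [3, 2, 2, 2] =
      2 * ∑ r ∈ Finset.range 4, (-1 : ℝ) ^ (r + 1) *
        ((zagierA (r + 1) 3 - zagierB (r + 1) 0 : ℚ) : ℝ) *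
          (multipleZeta [2 * r + 3] * multipleZeta (List.replicate (4 - 1 - r) 2)) := by
  simp only [Finset.sum_range_succ, Finset.sum_range_zero, zagierA_def, zagierB_def]
  push_cast
  norm_num [Nat.choose, List.replicate, multipleZeta_nil]
  linear_combination multipleZeta_three_two_two_two_eq + ((-3 : ℝ) * multipleZeta [3]) * multipleZeta_twos_three + ((15 / 2 : ℝ) * multipleZeta [5]) * multipleZeta_two_two + ((-189 / 16 : ℝ) * multipleZeta [7]) * multipleZeta_two

/-- **Zagier's theorem** (Brown 2012, Theorem 4.1) for `w = 2232` (`a = 2`, `b = 1`, weight `9`):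
`ζ_Brown(2,2,3,2) = multipleZeta [2, 3, 2, 2] = 2 ∑_{r=1}^{4} (-1)ʳ (A^r_{2,1} - B^r_{2,1}) ζ(2r+1) ζ({2}^{4-r})`.
[cite: Brown2012, Theorem 4.1] -/
theorem zagierFormula_2_1 :
    multipleZeta [2, 3, 2, 2] =
      2 * ∑ r ∈ Finset.range 4, (-1 : ℝ) ^ (r + 1) *
        ((zagierA (r + 1) 2 - zagierB (r + 1) 1 : ℚ) : ℝ) *
          (multipleZeta [2 * r + 3] * multipleZeta (List.replicate (4 - 1 - r) 2)) := by
  simp only [Finset.sum_range_succ, Finset.sum_range_zero, zagierA_def, zagierB_def]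
  push_cast
  norm_num [Nat.choose, List.replicate, multipleZeta_nil]
  linear_combination multipleZeta_two_three_two_two_eq + ((15 / 2 : ℝ) * multipleZeta [5]) * multipleZeta_two_two + ((-299 / 8 : ℝ) * multipleZeta [7]) * multipleZeta_two

/-- **Zagier's theorem** (Brown 2012, Theorem 4.1) for `w = 2322` (`a = 1`, `b = 2`, weight `9`):
`ζ_Brown(2,3,2,2) = multipleZeta [2, 2, 3, 2] = 2 ∑_{r=1}^{4} (-1)ʳ (A^r_{1,2} - B^r_{1,2}) ζ(2r+1) ζ({2}^{4-r})`.
[cite: Brown2012, Theorem 4.1] -/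
theorem zagierFormula_1_2 :
    multipleZeta [2, 2, 3, 2] =
      2 * ∑ r ∈ Finset.range 4, (-1 : ℝ) ^ (r + 1) *
        ((zagierA (r + 1) 1 - zagierB (r + 1) 2 : ℚ) : ℝ) *
          (multipleZeta [2 * r + 3] * multipleZeta (List.replicate (4 - 1 - r) 2)) := by
  simp only [Finset.sum_range_succ, Finset.sum_range_zero, zagierA_def, zagierB_def]
  push_cast
  norm_num [Nat.choose, List.replicate, multipleZeta_nil]
  linear_combination multipleZeta_two_two_three_two_eq + ((-2 : ℝ) * multipleZeta [5]) * multipleZeta_two_two + ((291 / 16 : ℝ) * multipleZeta [7]) * multipleZeta_two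

/-- **Zagier's theorem** (Brown 2012, Theorem 4.1) for `w = 3222` (`a = 0`, `b = 3`, weight `9`):
`ζ_Brown(3,2,2,2) = multipleZeta [2, 2, 2, 3] = 2 ∑_{r=1}^{4} (-1)ʳ (A^r_{0,3} - B^r_{0,3}) ζ(2r+1) ζ({2}^{4-r})`.
[cite: Brown2012, Theorem 4.1] -/
theorem zagierFormula_0_3 :
    multipleZeta [2, 2, 2, 3] =
      2 * ∑ r ∈ Finset.range 4, (-1 : ℝ) ^ (r + 1) *
        ((zagierA (r + 1) 0 - zagierB (r + 1) 3 : ℚ) : ℝ) *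
          (multipleZeta [2 * r + 3] * multipleZeta (List.replicate (4 - 1 - r) 2)) := by
  simp only [Finset.sum_range_succ, Finset.sum_range_zero, zagierA_def, zagierB_def]
  push_cast
  norm_num [Nat.choose, List.replicate, multipleZeta_nil]
  linear_combination multipleZeta_two_two_two_three_eq + ((2 : ℝ) * multipleZeta [3]) * multipleZeta_twos_three + ((-12 : ℝ) * multipleZeta [5]) * multipleZeta_two_two + ((30 : ℝ) * multipleZeta [7]) * multipleZeta_two

/-! ### Zagier's theorem in a whole odd weight `≤ 9`, and the level-one consequences unconditionally -/

/-- Zagier's Theorem 4.1 for all words of weight `3` (`n = 1`). [cite: Brown2012, Theorem 4.1] -/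
theorem zagierFormula_weight_three : ∀ b : ℕ, b < 1 →
    multipleZeta (List.replicate b 2 ++ 3 :: List.replicate (1 - 1 - b) 2) =
      2 * ∑ r ∈ Finset.range 1, (-1 : ℝ) ^ (r + 1) *
        ((zagierA (r + 1) (1 - 1 - b) - zagierB (r + 1) b : ℚ) : ℝ) *
          (multipleZeta [2 * r + 3] * multipleZeta (List.replicate (1 - 1 - r) 2)) := by
  intro b hb
  interval_cases b
  exact zagierFormula_0_0

/-- Zagier's Theorem 4.1 for all words of weight `5` (`n = 2`). [cite: Brown2012, Theorem 4.1] -/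
theorem zagierFormula_weight_five : ∀ b : ℕ, b < 2 →
    multipleZeta (List.replicate b 2 ++ 3 :: List.replicate (2 - 1 - b) 2) =
      2 * ∑ r ∈ Finset.range 2, (-1 : ℝ) ^ (r + 1) *
        ((zagierA (r + 1) (2 - 1 - b) - zagierB (r + 1) b : ℚ) : ℝ) *
          (multipleZeta [2 * r + 3] * multipleZeta (List.replicate (2 - 1 - r) 2)) := by
  intro b hb
  interval_cases b
  · exact zagierFormula_1_0
  · exact zagierFormula_0_1

/-- Zagier's Theorem 4.1 for all words of weight `7` (`n = 3`). [cite: Brown2012, Theorem 4.1] -/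
theorem zagierFormula_weight_seven : ∀ b : ℕ, b < 3 →
    multipleZeta (List.replicate b 2 ++ 3 :: List.replicate (3 - 1 - b) 2) =
      2 * ∑ r ∈ Finset.range 3, (-1 : ℝ) ^ (r + 1) *
        ((zagierA (r + 1) (3 - 1 - b) - zagierB (r + 1) b : ℚ) : ℝ) *
          (multipleZeta [2 * r + 3] * multipleZeta (List.replicate (3 - 1 - r) 2)) := by
  intro b hb
  interval_cases b
  · exact zagierFormula_2_0
  · exact zagierFormula_1_1
  · exact zagierFormula_0_2

/-- Zagier's Theorem 4.1 for all words of weight `9` (`n = 4`). [cite: Brown2012, Theorem 4.1] -/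
theorem zagierFormula_weight_nine : ∀ b : ℕ, b < 4 →
    multipleZeta (List.replicate b 2 ++ 3 :: List.replicate (4 - 1 - b) 2) =
      2 * ∑ r ∈ Finset.range 4, (-1 : ℝ) ^ (r + 1) *
        ((zagierA (r + 1) (4 - 1 - b) - zagierB (r + 1) b : ℚ) : ℝ) *
          (multipleZeta [2 * r + 3] * multipleZeta (List.replicate (4 - 1 - r) 2)) := by
  intro b hb
  interval_cases b
  · exact zagierFormula_3_0
  · exact zagierFormula_2_1
  · exact zagierFormula_1_2
  · exact zagierFormula_0_3

/-- **Unconditionally in weight `9`**: `ζ(9)`, `π²ζ(7)`, `π⁴ζ(5)`, `π⁶ζ(3) ∈ hoffmanSpan 9` by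
Brown's level-one argument (`isUnit_zagierMatrix` + Zagier's theorem in weight `9`, proved above) —
the end-to-end instance of `multipleZeta_odd_mem_hoffmanSpan_of_zagier`; of course also a
consequence of `hoffmanSpan_eq_mzvSpace_of_le_nine`. [cite: Brown2012, Theorems 7.3 and 7.4] -/
theorem multipleZeta_nine_mem_hoffmanSpan_levelOne : multipleZeta [9] ∈ hoffmanSpan 9 :=
  multipleZeta_odd_mem_hoffmanSpan_of_zagier 4 (by norm_num) zagierFormula_weight_nine

/-- `π^{2(3-j)} ζ(2j+3) ∈ hoffmanSpan 9` for `j < 4`, by the level-one argument.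
[cite: Brown2012, Theorems 7.3 and 7.4] -/
theorem pi_pow_mul_multipleZeta_odd_mem_hoffmanSpan_nine (j : ℕ) (hj : j < 4) :
    π ^ (2 * (4 - 1 - j)) * multipleZeta [2 * j + 3] ∈ hoffmanSpan 9 :=
  pi_pow_mul_multipleZeta_odd_mem_hoffmanSpan_of_zagier 4 zagierFormula_weight_nine j hj

end Brown2012

end Literature.NumberTheory.Transcendental
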